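/-
COR-CM (cell pub-hodgecm2) — RSCONJ («`RecordSystem.conj`», IDENT-LEMMA component (e) «SPACE by construction»; coordinator 04:22Z,
PLANNER-A RSCONJ TABLE HOME∕INBOX l.14934), row FRAME (part 1 of 2: §1 frame∕Gram∕ball, §2 finite-adelic side∕levels∕rational points, §4 `conjMc`) = the shared base of all RSCONJ rows; part 2 = `RecordSystemConjTwist.lean` (§3 `twist_smul`, §3b `conjAlgEquiv`), split only for the 400-line lint.  Lead pen prover-pub-hodgecm2-mukey-p6-g1-0;
the frame∕level definitions `conjFrame ∕ conjGram ∕ formCongr_conjFrame ∕ conjLevel₀ ∕ smallLevelConjBack` are mukey-p2 g1's (desk skeleton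
`RecordSystemConjSkeleton.lean` 0b87d68512da3d2b) verbatim up to namespace.  KERNEL: small definitions by explicit formula + theorems; no instance,
no named fact, no notation, no `sorry`.  HC_CM is NOT proved; HELD — WORLD = C FINAL; this file discharges no END binder and claims nothing about (iv-c).
-/
import Literature.AlgebraicGeometry.ShimuraVarieties.UnitaryShimuraRecordDescent
import Summits.HodgeConjecture.CorCM.D2Bridge.UnitaryGroupFinAdelicConj
import HarnessLib

/-!
# RSCONJ frame: the conjugate datum `(c(H), τ, T̄, c(K))` of a Deligne record `(H, τ, T, K)` and the transport bricks

Target of the RSCONJ chain (mukey-p2's typed skeleton): for a record system `R : RecordSystem L H τ T hT K₀` the twisted system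
`K' ↦ M_{c⁻¹K'} ⊗_{L,c} L` (= `Model.conjSystem`, `HComp/HonestP5.lean` :177) is a `RecordSystem L (c H) τ T̄ hT̄ (c K₀)`.
This file fixes the shared vocabulary and proves the algebraic transport identities every clause-row uses:

* §1 frame∕Gram: `conjFrame T = T̄`, `conjGram L H = c(H)`, `formCongr_conjFrame` (signature `(2,1)` at the SAME `τ`); the conjugate
  point of the ball `conjBall x = x̄`, `lift_conjBall`, `conjFrame_mulVec_star`; **`isLinePoint_conjFrame_iff`**
  (`T̄ x ∈ ℂ^× τ(v₃) ↔ T x̄ ∈ ℂ^× τ(c v₃)`).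
* §2 the finite-adelic side: `adeleConj = c ⊗ 1` on `𝔸_{L,f}` (an involution), `adelicVec_conj`, **`recipFactor_conj`**
  (`r(c s) = (c ⊗ 1) r(s)`), `hermForm_conj_eq_zero_iff`, `groupConj : U(H)(𝔸_f) ≃ₜ* U(cH)(𝔸_f)` (wb-10 ✔ `finAdelicConj`),
  **`isDiagTwist_conj_iff`**; levels `conjLevel₀`, `smallLevelConjBack` (+ `map_groupConj_smallLevelConjBack`); rational points
  `rationalConj : U(H)(L⁺) ≃* U(cH)(L⁺)` with `groupConj_rationalToFinAdelic`.
* §3 (any fields) `algEquivTwist` (`γ^σ = σ ∘ γ ∘ σ⁻¹`) and **`twist_smul`**: wb-1's twist of points along `σ` intertwines the LEFT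
  Galois actions, `twist (γ • P) = γ^σ • twist P` (for `ℂ ∕ conj`: complex conjugation of points carries `γ` to `conj ∘ γ ∘ conj`).

References: [Deligne1979ShimuraVarieties] 2.2.4–2.2.5; [Milne2005ShimuraVarieties] Def. 12.8, (62); [PlatonovRapinchuk1994] §5.1 (through wb-10's
`UnitaryGroupFinAdelicConj`); Hartshorne II Ex. 2.7 ∕ 4.7 (Galois action and twist of points, through wb-1's `BettiConjugateEmbedding`).
-/

set_option autoImplicit false

noncomputable section

open CategoryTheory AlgebraicGeometry NumberField IsDedekindDomain Matrix
open Literature.AlgebraicGeometry.Motives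
open Literature.NumberTheory.Automorphic.Liu2021.AppendixC (C5.OpenCompactSubgroup C5.SmallLevel)

universe u

namespace Summit.HodgeConjecture.CorCM.Model.RecordSystemConj

section DiagonalPairs

open Literature.AlgebraicGeometry.ShimuraVarieties Literature.AlgebraicGeometry.ShimuraVarieties.UnitaryCanonicalModel
open Literature.NumberTheory.Automorphic Literature.NumberTheory.Automorphic.UnitaryGroup
open Literature.Geometry.ComplexHyperbolic Literature.Geometry.ComplexHyperbolic.BallModel
open Summit.HodgeConjecture.CorCM.D2Bridge.UnitaryGroupConj

variable (L : Type) [Field L] [NumberField L] [IsCMField L]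

/-- The complex-conjugate frame `T̄` (entrywise `conj`; mukey-p2's `conjFrame`). [folklore] -/
def conjFrame (T : GL (Fin 3) ℂ) : GL (Fin 3) ℂ := Matrix.GeneralLinearGroup.map (starRingEnd ℂ) T

/-- `c(H)`: the Gram matrix of the conjugate hermitian space (entrywise CM conjugation; mukey-p2's `conjGram`). [folklore] -/
abbrev conjGram (H : Matrix (Fin 3) (Fin 3) L) : Matrix (Fin 3) (Fin 3) L :=
  H.map ((IsCMField.complexConj L : L ≃ₐ[↥(maximalRealSubfield L)] L) : L →+* L)


/-- `T̄` is a frame of signature `(2,1)` for `c(H)` at the SAME embedding `τ`: `T̄ᴴ (c H)^τ T̄ = conj (Tᴴ H^τ T) = conj J = J`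
(mukey-p2 g1, `RecordSystemConjSkeleton.lean` 0b87d68512da3d2b, verbatim). [folklore] -/
theorem formCongr_conjFrame (H : Matrix (Fin 3) (Fin 3) L) (τ : L →+* ℂ) (T : GL (Fin 3) ℂ)
    (hT : formCongr (starRingEnd ℂ) T (H.map τ) = BallModel.J) :
    formCongr (starRingEnd ℂ) (conjFrame T) ((conjGram L H).map τ) = BallModel.J := by
  have hcc : ((starRingEnd ℂ : ℂ → ℂ) ∘ (starRingEnd ℂ)) = id := funext (starRingEnd_self_apply)
  have hHc : (conjGram L H).map τ = (H.map τ).map (starRingEnd ℂ) := by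
    ext i j
    simp only [Matrix.map_apply, RingHom.coe_coe, NumberField.IsCMField.complexEmbedding_complexConj]
  have hT' : ((conjFrame T : GL (Fin 3) ℂ) : Matrix (Fin 3) (Fin 3) ℂ) =
      (T : Matrix (Fin 3) (Fin 3) ℂ).map (starRingEnd ℂ) := rfl
  have hJ : BallModel.J.map (starRingEnd ℂ) = BallModel.J := by
    ext i j
    fin_cases i <;> fin_cases j <;> simp [BallModel.J]
  have key := congrArg (fun M : Matrix (Fin 3) (Fin 3) ℂ => M.map (starRingEnd ℂ)) hT
  simp only [Matrix.map_mul, Matrix.transpose_map, Matrix.map_map, hcc, Matrix.map_id, hJ] at key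
  show (((conjFrame T : GL (Fin 3) ℂ) : Matrix (Fin 3) (Fin 3) ℂ).map (starRingEnd ℂ))ᵀ * (conjGram L H).map τ *
      ((conjFrame T : GL (Fin 3) ℂ) : Matrix (Fin 3) (Fin 3) ℂ) = BallModel.J
  rw [hT', hHc, Matrix.map_map, hcc, Matrix.map_id]
  exact key

/-- The complex-conjugate point `x̄` of the ball (`‖z̄ᵢ‖ = ‖zᵢ‖`). [folklore] -/
def conjBall (x : Ball) : Ball := ⟨star x.1, by simpa [nsq] using x.2⟩

/-- `x̄̄ = x`. [folklore] -/
@[simp] theorem conjBall_conjBall (x : Ball) : conjBall (conjBall x) = x := Subtype.ext (star_star x.1)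

/-- `lift x̄ = star (lift x)` (`conj 1 = 1`). [folklore] -/
theorem lift_conjBall (x : Ball) : BallModel.lift (conjBall x) = star (BallModel.lift x) := by
  ext i
  fin_cases i <;> simp [BallModel.lift, conjBall]

/-- Underlying matrix of `conjFrame T` is the entrywise conjugate. [folklore] -/
theorem coe_conjFrame (T : GL (Fin 3) ℂ) :
    ((conjFrame T : GL (Fin 3) ℂ) : Matrix (Fin 3) (Fin 3) ℂ) = (T : Matrix (Fin 3) (Fin 3) ℂ).map (starRingEnd ℂ) := rfl

/-- `T̄ ·ᵥ (star w) = star (T ·ᵥ w)`. [folklore] -/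
theorem conjFrame_mulVec_star (T : GL (Fin 3) ℂ) (w : Fin 3 → ℂ) :
    ((conjFrame T : GL (Fin 3) ℂ) : Matrix (Fin 3) (Fin 3) ℂ) *ᵥ star w = star ((T : Matrix (Fin 3) (Fin 3) ℂ) *ᵥ w) := by
  rw [coe_conjFrame]
  ext i
  simp only [Matrix.mulVec, dotProduct, Matrix.map_apply, Pi.star_apply, star_sum, star_mul', RCLike.star_def]

/-- **(F3)(ii-a)** `x` lies on the line `L·v₃` for the conjugate frame `T̄` iff `x̄` lies on the line `L·c(v₃)` for `T`
(`T̄ x ∈ ℂ^× τ(v₃)` ⟺ `T x̄ ∈ ℂ^× conj τ(v₃) = ℂ^× τ(c v₃)`, CM: `τ ∘ c = conj ∘ τ`). [folklore] -/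
theorem isLinePoint_conjFrame_iff (τ : L →+* ℂ) (T : GL (Fin 3) ℂ) (v₃ : Fin 3 → L) (x : Ball) :
    IsLinePoint L τ (conjFrame T) v₃ x ↔ IsLinePoint L τ T (fun i => IsCMField.complexConj L (v₃ i)) (conjBall x) := by
  have key : ∀ (c : ℂ),
      ((conjFrame T : GL (Fin 3) ℂ) : Matrix (Fin 3) (Fin 3) ℂ) *ᵥ BallModel.lift x = c • (fun i => τ (v₃ i)) ↔
        (T : Matrix (Fin 3) (Fin 3) ℂ) *ᵥ BallModel.lift (conjBall x) = (starRingEnd ℂ c) • fun i => τ (IsCMField.complexConj L (v₃ i)) := by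
    intro c
    have e1 : ((conjFrame T : GL (Fin 3) ℂ) : Matrix (Fin 3) (Fin 3) ℂ) *ᵥ BallModel.lift x =
        star ((T : Matrix (Fin 3) (Fin 3) ℂ) *ᵥ BallModel.lift (conjBall x)) := by
      rw [lift_conjBall, ← conjFrame_mulVec_star, star_star]
    rw [e1]
    constructor
    · intro hx
      have := congrArg star hx
      rw [star_star] at this
      rw [this]
      ext i
      simp [Pi.smul_apply, IsCMField.complexEmbedding_complexConj]
    · intro hx
      rw [hx]
      ext i
      simp [Pi.smul_apply, IsCMField.complexEmbedding_complexConj]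
  constructor
  · rintro ⟨c, hc, hx⟩
    exact ⟨starRingEnd ℂ c, (map_ne_zero _).2 hc, (key c).1 hx⟩
  · rintro ⟨c, hc, hx⟩
    refine ⟨starRingEnd ℂ c, (map_ne_zero _).2 hc, (key (starRingEnd ℂ c)).2 ?_⟩
    rwa [starRingEnd_self_apply]


/-! ### (ii-b,c) the finite-adelic side: `c ⊗ 1` on `𝔸_{L,f}`, the reciprocity factor and the diagonal twist -/

/-- The CM involution is its own inverse in `Aut(L/L⁺)`. [folklore] -/
theorem complexConj_inv : (IsCMField.complexConj L)⁻¹ = IsCMField.complexConj L :=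
  AlgEquiv.ext fun x => (IsCMField.complexConj L).injective (by
    rw [AlgEquiv.aut_inv, AlgEquiv.apply_symm_apply, IsCMField.complexConj_apply_apply])

/-- `c · c = 1` in `Aut(L/L⁺)`. [folklore] -/
theorem complexConj_mul_self : IsCMField.complexConj L * IsCMField.complexConj L = 1 :=
  mul_eq_one_iff_eq_inv.2 (complexConj_inv L).symm

/-- `c ⊗ 1` on the finite adeles of `L` (the tree's `conjFiniteAdele` at the CM involution). [folklore] -/
abbrev adeleConj : FiniteAdeleRing (𝓞 L) L →+* FiniteAdeleRing (𝓞 L) L :=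
  conjFiniteAdele (↥(maximalRealSubfield L)) L (IsCMField.complexConj L)

/-- `c⁻¹ ⊗ 1 = c ⊗ 1`. [folklore] -/
theorem conjFiniteAdele_inv :
    conjFiniteAdele (↥(maximalRealSubfield L)) L (IsCMField.complexConj L)⁻¹ = adeleConj L := by
  rw [complexConj_inv]

/-- `(c ⊗ 1)` is an involution of `𝔸_{L,f}`. [folklore] -/
@[simp] theorem adeleConj_adeleConj (x : FiniteAdeleRing (𝓞 L) L) : adeleConj L (adeleConj L x) = x := by
  simp only [adeleConj, conjFiniteAdele_apply, smul_smul, complexConj_mul_self, one_smul]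

/-- `(c ⊗ 1) ∘ (c ⊗ 1) ∘ u = u` on vectors. [folklore] -/
theorem adeleConj_comp_adeleConj_comp {n : Type*} (u : n → FiniteAdeleRing (𝓞 L) L) :
    ⇑(adeleConj L) ∘ (⇑(adeleConj L) ∘ u) = u :=
  funext fun i => adeleConj_adeleConj L (u i)

/-- `u ↦ (c ⊗ 1) ∘ u` is injective on vectors. [folklore] -/
theorem comp_adeleConj_injective {n : Type*} {u u' : n → FiniteAdeleRing (𝓞 L) L}
    (h : ⇑(adeleConj L) ∘ u = ⇑(adeleConj L) ∘ u') : u = u' := by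
  rw [← adeleConj_comp_adeleConj_comp L u, h, adeleConj_comp_adeleConj_comp]

/-- `(c v)_𝔸 = (c ⊗ 1) (v_𝔸)` on vectors of `L³`. [folklore] -/
theorem adelicVec_conj (v : Fin 3 → L) :
    adelicVec L (fun i => IsCMField.complexConj L (v i)) = ⇑(adeleConj L) ∘ adelicVec L v :=
  funext fun i => algebraMap_galConj_finiteAdele (↥(maximalRealSubfield L)) L (IsCMField.complexConj L) (v i)

/-- `(D^{c ⊗ 1}) ((c ⊗ 1) ∘ w) = (c ⊗ 1) ∘ (D w)`. [folklore] -/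
theorem map_adeleConj_mulVec (D : Matrix (Fin 3) (Fin 3) (FiniteAdeleRing (𝓞 L) L)) (w : Fin 3 → FiniteAdeleRing (𝓞 L) L) :
    D.map (adeleConj L) *ᵥ (⇑(adeleConj L) ∘ w) = ⇑(adeleConj L) ∘ (D *ᵥ w) :=
  funext fun i => (RingHom.map_mulVec (adeleConj L) D w i).symm

/-- **(F3)(ii-c)** the reciprocity factor of the conjugate idèle: `r(c s) = (c ⊗ 1) r(s)` (`r(s) = c(s)·s⁻¹`). [folklore] -/
theorem recipFactor_conj (s : (FiniteAdeleRing (𝓞 L) L)ˣ) :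
    recipFactor L (Units.map (adeleConj L : FiniteAdeleRing (𝓞 L) L →* FiniteAdeleRing (𝓞 L) L) s) =
      adeleConj L (recipFactor L s) := by
  simp only [recipFactor, Units.coe_map, Units.coe_map_inv, map_mul, MonoidHom.coe_coe]

/-- `h_H(w, c v) = 0 ↔ h_{c(H)}(c w, v) = 0` (apply `c`: `c (h_H(w, c v)) = h_{cH}(c w, v)`). [folklore] -/
theorem hermForm_conj_eq_zero_iff (H : Matrix (Fin 3) (Fin 3) L) (w v : Fin 3 → L) :
    hermForm (cmConjRingHom L) H w (fun i => IsCMField.complexConj L (v i)) = 0 ↔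
      hermForm (cmConjRingHom L) (conjGram L H) (fun i => IsCMField.complexConj L (w i)) v = 0 := by
  have hcc : ∀ u : Fin 3 → L, (⇑(cmConjRingHom L) ∘ fun i => IsCMField.complexConj L (u i)) = u :=
    fun u => funext fun i => IsCMField.complexConj_apply_apply L (u i)
  have hcc2 : ∀ u : Fin 3 → L, ⇑(cmConjRingHom L) ∘ (⇑(cmConjRingHom L) ∘ u) = u :=
    fun u => funext fun i => IsCMField.complexConj_apply_apply L (u i)
  have hmap : H.map ⇑(cmConjRingHom L) = conjGram L H := Matrix.ext fun i j => rfl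
  have hmv : ⇑(cmConjRingHom L) ∘ (H *ᵥ fun i => IsCMField.complexConj L (v i)) = conjGram L H *ᵥ v := by
    have h1 : ⇑(cmConjRingHom L) ∘ (H *ᵥ fun i => IsCMField.complexConj L (v i)) =
        H.map ⇑(cmConjRingHom L) *ᵥ (⇑(cmConjRingHom L) ∘ fun i => IsCMField.complexConj L (v i)) :=
      funext fun i => RingHom.map_mulVec _ _ _ i
    rw [h1, hcc, hmap]
  have key : cmConjRingHom L (hermForm (cmConjRingHom L) H w fun i => IsCMField.complexConj L (v i)) =
      hermForm (cmConjRingHom L) (conjGram L H) (fun i => IsCMField.complexConj L (w i)) v := by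
    change cmConjRingHom L ((⇑(cmConjRingHom L) ∘ w) ⬝ᵥ (H *ᵥ fun i => IsCMField.complexConj L (v i))) =
      (⇑(cmConjRingHom L) ∘ fun i => IsCMField.complexConj L (w i)) ⬝ᵥ (conjGram L H *ᵥ v)
    rw [RingHom.map_dotProduct, hcc2, hmv, hcc]
  rw [← key, map_eq_zero_iff _ (cmConjRingHom L).injective]

/-- `((c ⊗ 1) D)^{c ⊗ 1} = D` entrywise. [folklore] -/
@[simp] theorem map_adeleConj_map_adeleConj (D : Matrix (Fin 3) (Fin 3) (FiniteAdeleRing (𝓞 L) L)) :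
    (D.map (adeleConj L)).map (adeleConj L) = D :=
  Matrix.ext fun i j => adeleConj_adeleConj L (D i j)

variable (H : Matrix (Fin 3) (Fin 3) L)

/-- `U(H)(𝔸_{L⁺,f}) ≃ₜ* U(cH)(𝔸_{L⁺,f})`, `g ↦ (c ⊗ 1) g` (wb-10's `finAdelicConj` at `J' := c(H)`; mukey-p2's `groupConj`). [folklore] -/
abbrev groupConj :
    ↥(finAdelic (↥(maximalRealSubfield L)) L (IsCMField.complexConj L) 3 H) ≃ₜ*
      ↥(finAdelic (↥(maximalRealSubfield L)) L (IsCMField.complexConj L) 3 (conjGram L H)) :=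
  finAdelicConj (↥(maximalRealSubfield L)) L (IsCMField.complexConj L) 3 rfl

/-- Underlying matrix of `groupConj⁻¹ d`: the entrywise `(c ⊗ 1)`-conjugate. [folklore] -/
theorem coe_groupConj_symm (d : finAdelic (↥(maximalRealSubfield L)) L (IsCMField.complexConj L) 3 (conjGram L H)) :
    ((((groupConj L H).symm d : finAdelic (↥(maximalRealSubfield L)) L (IsCMField.complexConj L) 3 H) :
        GL (Fin 3) (FiniteAdeleRing (𝓞 L) L)) : Matrix (Fin 3) (Fin 3) (FiniteAdeleRing (𝓞 L) L)) =
      ((d : GL (Fin 3) (FiniteAdeleRing (𝓞 L) L)) : Matrix (Fin 3) (Fin 3) (FiniteAdeleRing (𝓞 L) L)).map (adeleConj L) := by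
  rw [← conjFiniteAdele_inv]
  rfl

/-- **(F3)(ii-b)** the diagonal twist transports under `c`: `d ∈ U(cH)(𝔸_f)` twists `v₃` by `t` (for `c(H)`) iff `(c ⊗ 1)⁻¹ d ∈ U(H)(𝔸_f)`
twists `c(v₃)` by `(c ⊗ 1) t` (for `H`). [folklore] -/
theorem isDiagTwist_conj_iff (v₃ : Fin 3 → L) (t : FiniteAdeleRing (𝓞 L) L)
    (d : finAdelic (↥(maximalRealSubfield L)) L (IsCMField.complexConj L) 3 (conjGram L H)) :
    IsDiagTwist L (conjGram L H) v₃ t d ↔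
      IsDiagTwist L H (fun i => IsCMField.complexConj L (v₃ i)) (adeleConj L t) ((groupConj L H).symm d) := by
  have hcc : ∀ u : Fin 3 → L, (fun i => IsCMField.complexConj L (IsCMField.complexConj L (u i))) = u :=
    fun u => funext fun i => IsCMField.complexConj_apply_apply L (u i)
  simp only [IsDiagTwist, adelicVec_conj]
  rw [coe_groupConj_symm]
  constructor
  · rintro ⟨h1, h2⟩
    refine ⟨?_, fun w hw => ?_⟩
    · rw [map_adeleConj_mulVec, h1]
      funext i
      simp only [Function.comp_apply, Pi.smul_apply, smul_eq_mul, map_mul]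
    · have hw' := (hermForm_conj_eq_zero_iff L H w v₃).1 hw
      have h2w := h2 (fun i => IsCMField.complexConj L (w i)) hw'
      rw [adelicVec_conj] at h2w
      apply comp_adeleConj_injective L
      rw [← map_adeleConj_mulVec, map_adeleConj_map_adeleConj]
      exact h2w
  · rintro ⟨h1, h2⟩
    refine ⟨?_, fun w hw => ?_⟩
    · apply comp_adeleConj_injective L
      rw [← map_adeleConj_mulVec, h1]
      funext i
      simp only [Function.comp_apply, Pi.smul_apply, smul_eq_mul, map_mul]
    · have hw' : hermForm (cmConjRingHom L) H (fun i => IsCMField.complexConj L (w i))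
          (fun i => IsCMField.complexConj L (v₃ i)) = 0 := by
        rw [hermForm_conj_eq_zero_iff, hcc]; exact hw
      have h2w := h2 (fun i => IsCMField.complexConj L (w i)) hw'
      rw [adelicVec_conj, map_adeleConj_mulVec] at h2w
      exact comp_adeleConj_injective L h2w


/-! ### levels: the threshold `c(K₀)` and the re-indexing of small levels (mukey-p2 g1, skeleton 0b87d68512da3d2b, verbatim) -/

variable (K₀ : C5.OpenCompactSubgroup ↥(finAdelic (↥(maximalRealSubfield L)) L (IsCMField.complexConj L) 3 H))

/-- the transported threshold `c(K₀) ≤ U(cH)(𝔸_{L⁺,f})`. [folklore] -/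
abbrev conjLevel₀ : C5.OpenCompactSubgroup ↥(finAdelic (↥(maximalRealSubfield L)) L (IsCMField.complexConj L) 3 (conjGram L H)) :=
  C5.OpenCompactSubgroup.transport (groupConj L H) K₀

/-- re-indexing of the small levels BACK: `K' ≤ c(K₀)` ↦ `c⁻¹(K') ≤ K₀`. [folklore] -/
def smallLevelConjBack : C5.SmallLevel (conjLevel₀ L H K₀) ⥤ C5.SmallLevel K₀ :=
  Monotone.functor
    (f := fun K' : C5.SmallLevel (conjLevel₀ L H K₀) =>
      (⟨C5.OpenCompactSubgroup.transport (groupConj L H).symm K'.1, by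
        change (C5.OpenCompactSubgroup.transport (groupConj L H).symm K'.1).1 ≤ K₀.1
        intro x hx
        obtain ⟨y, hy, rfl⟩ := Subgroup.mem_map.1 hx
        obtain ⟨z, hz, rfl⟩ := Subgroup.mem_map.1 (K'.2 hy)
        convert hz using 2
        exact (groupConj L H).symm_apply_apply z⟩ : C5.SmallLevel K₀))
    (fun _ _ h => C5.OpenCompactSubgroup.transport_mono (groupConj L H).symm h)

/-- the underlying subgroup of the re-indexed level is `(c ⊗ 1)⁻¹ K'`. [folklore] -/
@[simp] theorem smallLevelConjBack_obj_val_val (K' : C5.SmallLevel (conjLevel₀ L H K₀)) :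
    (((smallLevelConjBack L H K₀).obj K').1.1 :
        Subgroup ↥(finAdelic (↥(maximalRealSubfield L)) L (IsCMField.complexConj L) 3 H)) =
      (K'.1.1 : Subgroup _).map (groupConj L H).symm.toMonoidHom := rfl

/-- `(c ⊗ 1) ((c ⊗ 1)⁻¹ K') = K'`: transporting the re-indexed level forward recovers `K'`. [folklore] -/
theorem map_groupConj_smallLevelConjBack (K' : C5.SmallLevel (conjLevel₀ L H K₀)) :
    ((((smallLevelConjBack L H K₀).obj K').1.1 :
        Subgroup ↥(finAdelic (↥(maximalRealSubfield L)) L (IsCMField.complexConj L) 3 H)).map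
        (groupConj L H).toMonoidHom) = K'.1.1 := by
  rw [smallLevelConjBack_obj_val_val, Subgroup.map_map]
  have hid : (groupConj L H).toMonoidHom.comp (groupConj L H).symm.toMonoidHom = MonoidHom.id _ :=
    MonoidHom.ext fun x => (groupConj L H).apply_symm_apply x
  rw [hid, Subgroup.map_id]

/-! ### rational points: `γ ↦ c(γ)`, `U(H)(L⁺) ≃* U(cH)(L⁺)`, compatible with the diagonal embedding -/

/-- **Galois conjugation on RATIONAL points** `U(H)(L⁺) ≃* U(cH)(L⁺)`, `γ ↦ c γ` (entrywise; wb-10's membership lemmas). [folklore] -/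
def rationalConj :
    ↥(rational (↥(maximalRealSubfield L)) L (IsCMField.complexConj L) 3 H) ≃*
      ↥(rational (↥(maximalRealSubfield L)) L (IsCMField.complexConj L) 3 (conjGram L H)) where
  toFun γ := ⟨Matrix.GeneralLinearGroup.map ((IsCMField.complexConj L : L ≃ₐ[↥(maximalRealSubfield L)] L) : L →+* L) γ.1,
    map_galConj_mem_rational (↥(maximalRealSubfield L)) L (IsCMField.complexConj L) 3 rfl γ.2⟩
  invFun γ := ⟨Matrix.GeneralLinearGroup.map (((IsCMField.complexConj L)⁻¹ : L ≃ₐ[↥(maximalRealSubfield L)] L) : L →+* L) γ.1,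
    map_galConj_inv_mem_rational (↥(maximalRealSubfield L)) L (IsCMField.complexConj L) 3 rfl γ.2⟩
  left_inv γ := Subtype.ext (glMap_galConj_inv_glMap_galConj (↥(maximalRealSubfield L)) L (IsCMField.complexConj L) 3 γ.1)
  right_inv γ := Subtype.ext (glMap_galConj_glMap_galConj_inv (↥(maximalRealSubfield L)) L (IsCMField.complexConj L) 3 γ.1)
  map_mul' γ γ' := Subtype.ext (map_mul _ γ.1 γ'.1)

/-- underlying matrix of `rationalConj γ`: the entrywise conjugate. [folklore] -/
@[simp] theorem coe_rationalConj (γ : rational (↥(maximalRealSubfield L)) L (IsCMField.complexConj L) 3 H) :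
    ((rationalConj L H γ : rational (↥(maximalRealSubfield L)) L (IsCMField.complexConj L) 3 (conjGram L H)) : GL (Fin 3) L) =
      Matrix.GeneralLinearGroup.map ((IsCMField.complexConj L : L ≃ₐ[↥(maximalRealSubfield L)] L) : L →+* L) γ.1 := rfl

/-- **compatibility with the diagonal embedding**: `(c ⊗ 1)(γ)_f = (c γ)_f`. [folklore] -/
theorem groupConj_rationalToFinAdelic (γ : rational (↥(maximalRealSubfield L)) L (IsCMField.complexConj L) 3 H) :
    groupConj L H (rationalToFinAdelic (↥(maximalRealSubfield L)) L (IsCMField.complexConj L) 3 H γ) =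
      rationalToFinAdelic (↥(maximalRealSubfield L)) L (IsCMField.complexConj L) 3 (conjGram L H) (rationalConj L H γ) :=
  Subtype.ext (coe_finAdelicConj_rationalToFinAdelic (↥(maximalRealSubfield L)) L (IsCMField.complexConj L) 3 rfl γ)

end DiagonalPairs

/-! ## §4 the conjugate COMPLEX models `K' ↦ (Mc_{c⁻¹K'})^{conj}` (shared with rows F2b ∕ F2c ∕ Sc′-LIT ∕ A) -/

section ConjComplex

open Literature.AlgebraicGeometry.ShimuraVarieties Literature.AlgebraicGeometry.ShimuraVarieties.UnitaryCanonicalModel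
open Literature.NumberTheory.Automorphic Literature.NumberTheory.Automorphic.UnitaryGroup
open Literature.Geometry.ComplexHyperbolic Literature.Geometry.ComplexHyperbolic.BallModel

variable {L : Type} [Field L] [NumberField L] [IsCMField L] {H : Matrix (Fin 3) (Fin 3) L} {τ : L →+* ℂ} {T : GL (Fin 3) ℂ}
  {hT : formCongr (starRingEnd ℂ) T (H.map τ) = BallModel.J}
  {K₀ : C5.OpenCompactSubgroup ↥(finAdelic (↥(maximalRealSubfield L)) L (IsCMField.complexConj L) 3 H)}

/-- **The conjugate complex models** of a complex record system: `K' ↦ (Mc_{c⁻¹K'})^{conj} = Mc_{c⁻¹K'} ⊗_{ℂ, conj} ℂ`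
(re-indexed by the levels of `U(cH)`). [cite: Deligne1979ShimuraVarieties, 2.1.2] -/
def conjMc (Sc : ComplexRecordSystem L H τ T hT K₀) : C5.SmallLevel (conjLevel₀ L H K₀) ⥤ SchemeOver ℂ :=
  smallLevelConjBack L H K₀ ⋙ Sc.Mc ⋙ Literature.AlgebraicGeometry.Motives.baseChangeHom (starRingAut : ℂ ≃+* ℂ).toRingHom

/-- unfolding: `(conjMc Sc) K' = conjugateVariety conj (Mc_{c⁻¹K'})` (by `rfl`). [folklore] -/
@[simp] theorem conjMc_obj (Sc : ComplexRecordSystem L H τ T hT K₀) (K' : C5.SmallLevel (conjLevel₀ L H K₀)) :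
    (conjMc Sc).obj K' = conjugateVariety (starRingAut : ℂ ≃+* ℂ) (Sc.Mc.obj ((smallLevelConjBack L H K₀).obj K')) := rfl

/-- unfolding: the transition maps of `conjMc Sc` are the conjugated transition maps of `Sc`. [folklore] -/
theorem conjMc_map (Sc : ComplexRecordSystem L H τ T hT K₀) {K₁ K₂ : C5.SmallLevel (conjLevel₀ L H K₀)} (f : K₁ ⟶ K₂) :
    (conjMc Sc).map f = (Literature.AlgebraicGeometry.Motives.baseChangeHom (starRingAut : ℂ ≃+* ℂ).toRingHom).map
      (Sc.Mc.map ((smallLevelConjBack L H K₀).map f)) := rfl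

/-- `(Mc_K)^{conj}` is smooth of relative dimension `2` (base change). [folklore] -/
theorem smooth_conjMc (Sc : ComplexRecordSystem L H τ T hT K₀) (K' : C5.SmallLevel (conjLevel₀ L H K₀)) :
    AlgebraicGeometry.SmoothOfRelativeDimension 2 ((conjMc Sc).obj K').hom := by
  have := AlgebraicGeometry.smoothOfRelativeDimension_isStableUnderBaseChange 2
  exact MorphismProperty.pullback_snd (P := @AlgebraicGeometry.SmoothOfRelativeDimension 2) _ _ (Sc.smooth _)

/-- `(Mc_K)^{conj}` is projective over `ℂ` (base change). [folklore] -/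
theorem projective_conjMc (Sc : ComplexRecordSystem L H τ T hT K₀) (K' : C5.SmallLevel (conjLevel₀ L H K₀)) :
    IsProjectiveOver ((conjMc Sc).obj K') :=
  letI : Algebra ℂ ℂ := ((starRingAut : ℂ ≃+* ℂ).toRingHom).toAlgebra
  (Sc.projective ((smallLevelConjBack L H K₀).obj K')).baseChange_obj ℂ

end ConjComplex


end Summit.HodgeConjecture.CorCM.Model.RecordSystemConj

end
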